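import Literature.Analysis.DeBrangesSpaces.BurnolXPairingKernelIdentity
import HarnessLib

/-!
# Burnol 2001 (CRAS 333), §1, proof of Théorème 1.5: "`𝓕₊(X^λ_{w,k})` et `(−1)^k X_{1−w,k}` ont la
même projection sur `K_{λ,λ}`"

The last step of Burnol's proof of Théorème 1.5 (TeX l.416–420): "On remarque finalement pour
`Re(w) < 1/2` par l'équation (1.1) l'identité `(𝓕₊(f), X^λ_{w,k}] = (d^k/d^kw)(f̂(w))` qui montre que
`𝓕₊(X^λ_{w,k})` et `(−1)^k X_{1−w,k}` ont la même projection sur `K_{λ,λ}`."  In the typed pairing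
language (`xPairingR`, faithful compensated function `IsXPairingFnC`): for `f ∈ K_{λ,λ}` with data
`(G, P)` and `𝓕f ∈ K_{λ,λ}` with data `(G', P')`, and `Re w < 1/2`,

  `xPairingR G P w k = (−1)^k · xPairingR G' P' (1 − w) k`     (`xPairingR_fourier_swap`),

because `P = G_{𝓕f} = G'` (eq. (1.1), `IsXPairingFnC.eq_sonineMellinExt`) and
`(d/dv)^k G'(1 − v)|_{v = 1−w} = (−1)^k G'^{(k)}(w)`.  This converts the `Re w < 1/2` functionals on
`f` into `Re w' > 1/2` functionals on `𝓕f` — the "𝓕-swap" of the assembly of Théorème 1.5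
(`Burnol2001CRAS_thm1_5C`).  RH-FREE.

## References
* [Burnol2001CRAS] J.-F. Burnol, C. R. Acad. Sci. Paris 333 (2001) 201–206, §1, proof of Thm. 1.5
  (TeX l.409–420).
-/

open MeasureTheory Set Filter Complex Metric
open scoped Real Topology ENNReal FourierTransform

open Literature.NumberTheory.ConnesConsani2021 (soninSpace)
open Literature.Analysis.DeBrangesSpaces.SonineMellin (cosKernel sonineMellinExt
  differentiable_sonineMellinExt sonineMellinExt_eq_mellin)

namespace Literature.Analysis.DeBrangesSpaces

namespace Burnol2001

/-- The entire Mellin continuation of `f ∈ K_{λ,λ}` IS `sonineMellinExt λ λ (𝓕f)` (uniqueness of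
the continuation from `Re s < 1/2`). [cite: Burnol2001CRAS, Théorème 1.1 and eq. (1.2) (TeX l.320–332)] -/
theorem HasEntireMellin.eq_sonineMellinExt {lam : ℝ} (hlam : 0 < lam) {f : Lp ℂ 2 (volume : Measure ℝ)}
    (hf : f ∈ soninSpace lam lam) {G : ℂ → ℂ} (hG : HasEntireMellin f G) :
    G = sonineMellinExt lam lam ((𝓕 f : Lp ℂ 2 (volume : Measure ℝ)) : ℝ → ℂ) := by
  obtain ⟨heven, hfa, hFb⟩ := hf
  have hW : IsOpen {w : ℂ | w.re < 1 / 2} := isOpen_lt Complex.continuous_re continuous_const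
  have hev : G =ᶠ[𝓝 (0 : ℂ)] sonineMellinExt lam lam ((𝓕 f : Lp ℂ 2 (volume : Measure ℝ)) : ℝ → ℂ) := by
    filter_upwards [hW.mem_nhds (by norm_num : (0 : ℂ) ∈ {w : ℂ | w.re < 1 / 2})] with z hz
    rw [hG.2 z hz, sonineMellinExt_eq_mellin hlam hlam f heven hfa hFb hz]
  have h1 : AnalyticOnNhd ℂ G univ := hG.1.differentiableOn.analyticOnNhd isOpen_univ
  have h2 : AnalyticOnNhd ℂ (sonineMellinExt lam lam ((𝓕 f : Lp ℂ 2 (volume : Measure ℝ)) : ℝ → ℂ))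
      univ := (differentiable_sonineMellinExt hlam hlam _).differentiableOn.analyticOnNhd isOpen_univ
  exact funext fun z ↦
    h1.eqOn_of_preconnected_of_eventuallyEq h2 isPreconnected_univ (mem_univ 0) hev (mem_univ z)

/-- **For `f ∈ K_{λ,λ}` the compensated pairing function of `f` is the Mellin continuation of `𝓕f`**:
with `(G, P)` the data of `f` and `G'` the entire Mellin continuation of `𝓕f`, `P = G'`.
[cite: Burnol2001CRAS, §1, eq. (1.1) and TeX l.398–403] -/
theorem IsXPairingFnC.eq_hasEntireMellin_fourier {lam : ℝ} (hlam : 0 < lam)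
    {f : Lp ℂ 2 (volume : Measure ℝ)} (hf : f ∈ soninSpace lam lam) {G P G' : ℂ → ℂ}
    (hG : HasEntireMellin f G) (hP : IsXPairingFnC G P)
    (hG' : HasEntireMellin (𝓕 f : Lp ℂ 2 (volume : Measure ℝ)) G') : P = G' := by
  obtain ⟨hFmem, hFF⟩ := fourier_mem_soninSpace_swap hf
  rw [hP.eq_sonineMellinExt hlam hf hG, hG'.eq_sonineMellinExt hlam hFmem, hFF]

/-- **The 𝓕-swap of Théorème 1.5's proof**: for `f ∈ K_{λ,λ}` with data `(G, P)`, `𝓕f` with data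
`(G', P')`, and `Re w < 1/2`: `(f, X^λ_{w,k}] = (−1)^k (𝓕f, X^λ_{1−w,k}]`, i.e.
`xPairingR G P w k = (−1)^k · xPairingR G' P' (1 − w) k` ("`𝓕₊(X^λ_{w,k})` et `(−1)^k X_{1−w,k}` ont
la même projection sur `K_{λ,λ}`"). [cite: Burnol2001CRAS, §1, proof of Théorème 1.5 (TeX l.416–420)] -/
theorem xPairingR_fourier_swap {lam : ℝ} (hlam : 0 < lam) {f : Lp ℂ 2 (volume : Measure ℝ)}
    (hf : f ∈ soninSpace lam lam) {G P G' : ℂ → ℂ} (hG : HasEntireMellin f G)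
    (hP : IsXPairingFnC G P) (hG' : HasEntireMellin (𝓕 f : Lp ℂ 2 (volume : Measure ℝ)) G')
    (P' : ℂ → ℂ) (k : ℕ) {w : ℂ} (hw : w.re < 1 / 2) :
    xPairingR G P w k = (-1) ^ k * xPairingR G' P' (1 - w) k := by
  have hw' : ¬ (1 / 2 : ℝ) < w.re := not_lt.2 hw.le
  have hw'' : (1 / 2 : ℝ) < (1 - w).re := by rw [sub_re, one_re]; linarith
  rw [xPairingR, if_neg hw', xPairingR, if_pos hw'', hP.eq_hasEntireMellin_fourier hlam hf hG hG',
    iteratedDeriv_comp_const_sub]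
  dsimp only
  rw [sub_sub_cancel, smul_eq_mul, ← mul_assoc, ← mul_pow, neg_mul_neg, one_mul, one_pow, one_mul]

end Burnol2001

end Literature.Analysis.DeBrangesSpaces
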